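import Summits.BirchSwinnertonDyer.BirchSwinnertonDyer.Theorems.ShaPrimaryTransferFiniteShaComponentTransferRankTwoDoor
import Summits.BirchSwinnertonDyer.BirchSwinnertonDyer.Theorems.Rank1ResidualIntModelReduction
import Summits.BirchSwinnertonDyer.Rank1Residual.Additive.PointCountEulerNat
import Literature.NumberTheory.EllipticCurves.Zywina2025Torsion
import Literature.NumberTheory.EllipticCurves.Kato2004.ShaFiniteOfOrderLeRankProofs

/-!
# BirchSwinnertonDyer / ShaPrimaryTransfer — crux `FiniteShaComponentTransfer` (stmt-BirchSwinnertonDyer-22356):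
# the first CONCRETE CELL of the cross-prime table — `E_{659,12}`, door `p₀ = 2`, target `q = 5`

Companions: `…RankTwoDoor` (the door at `2` is open at rank `2` in the kernel on Zywina's family; explicit pair
`(m, n) = (659, 12)`), `…CrossPrimeRow` (the row at an odd good ordinary `q`: Kato Thm. 18.4 + one `T²`-coefficient
certificate ⟹ `t_q = 0`). Here the target prime is made EXPLICIT for the explicit curve
`E_{659,12} : y² = x³ − 14815 x² + 50477668 x` (`q = m + 16n² = 2963`, `r = m + 25n² = 4259`, `a₂ = −5q`, `a₄ = 4qr`):

* `intModel_659_12` — the tree's integral (global minimal) model of `E_{659,12}` is the literal integer equation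
  `[0, −14815, 0, 50477668, 0]` (Zywina: the equation is minimal; tree `integralModelInt_zywinaCurve`).
* `card_five_659_12` — `#Ẽ(𝔽₅) = 10`, kernel-decided (`ℕ`-arithmetic Euler count `PointCountNat.natCard_point_map_eq`);
  so `a₅(E_{659,12}) = −4` (`frobeniusTrace_five_659_12`).
* `goodOrdinary_five_659_12` — **`5` is a prime of GOOD ORDINARY reduction of `E_{659,12}`** (`5 ∤ Δ_min =
  2⁸·3²·659·2963³·4259²`, `5 ∤ a₅`), UNCONDITIONAL. Hence KatoTransfer's X2 / Kato's Thm. 18.4 / the `λ`-door all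
  dock at `q = 5` for this curve.
* `crossPrimeRow_659_12_five` — THE CELL: granting Kato's Thm. 18.4 at `5` for `E_{659,12}` (named fact, with its
  newform `f`) and the ONE numerical certificate `[T²] L_5(E_{659,12}, T) ≠ 0` (`α₅` the unit root):
  `t_5(E_{659,12}) = 0`, `corank_{ℤ₅} Sel_{5^∞}(E_{659,12}/ℚ) = 2`, `ord_{T=0} L_5 = 2` — T's instance
  `(E_{659,12}, 2, 5)` VERIFIED modulo print + certificate. What a data seat would compute: the `5`-adic
  `L`-series of `[0, −14815, 0, 50477668, 0]` to precision separating its `T²`-coefficient from `0`.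
* `analyticRank_659_12_le_of_X2` — granting X2 = `AnalyticRankLeSelmerCorank` at `q = 5`:
  `ord_{s=1} L(E_{659,12}, s) ≤ 2 + t_5(E_{659,12})`; with T (door at `2`) or with the cell: `≤ 2`.

Prover seat `bsd-line-spt-p1` g2, `--supports stmt-22356 --as helper`. Nothing here proves T, X2 or BSD; no certificate
is computed in Lean.

References: D. Zywina, arXiv:2502.01957 (2025), Thm. 1.2; K. Kato, Astérisque 295 (2004), Thm. 18.4 (p. 281);
W. Stein, C. Wuthrich, Math. Comp. 82 (2013), Algorithm 11.1 (3); J. H. Silverman, *AEC* (2009), VII.5.1, V.2.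
-/

-- D-0017: single-problem summit, so `Summit.BirchSwinnertonDyer.BirchSwinnertonDyer.…` repeats a namespace BY DESIGN.
set_option linter.dupNamespace false

noncomputable section

namespace Summit.BirchSwinnertonDyer.BirchSwinnertonDyer.Theorems.ShaPrimaryTransferRowAtFive

open scoped Classical MatrixGroups ModularForm
open CongruenceSubgroup
open Literature.NumberTheory.EllipticCurves Literature.NumberTheory.EllipticCurves.Zywina2025
  Literature.NumberTheory.EllipticCurves.ModularForms
open WeierstrassCurve
open Summit.BirchSwinnertonDyer.BirchSwinnertonDyer.Rank1Residual
open Summit.BirchSwinnertonDyer.Rank1Residual.Additive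
open Summit.BirchSwinnertonDyer.BirchSwinnertonDyer.Theses.ShaPrimaryTransfer
  (FiniteShaComponentTransfer AnalyticRankLeSelmerCorank)
open Summit.BirchSwinnertonDyer.BirchSwinnertonDyer.Theorems.ShaPrimaryTransferRankTwoDoor (zywinaAdmissible_659_12)

/-! ## The explicit curve `E_{659,12}` -/

/-- `E_{659,12}` is an elliptic curve (the instance the statements below take as `[ … ]`). [cite: Zywina2025, Thm 1.2] -/
theorem isElliptic_659_12 : (zywinaCurve 659 12).IsElliptic := isElliptic_zywinaCurve zywinaAdmissible_659_12

/-- `E_{659,12}` is given by a global minimal equation (tree `isGloballyMinimal_zywinaCurve`; the instance the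
statements below take as `[ … ]`). [cite: Zywina2025, Lemma 3.4] -/
theorem isGloballyMinimal_659_12 : (zywinaCurve 659 12).IsGloballyMinimal :=
  isGloballyMinimal_zywinaCurve zywinaAdmissible_659_12

/-- The integer equation of `E_{659,12}` is `[0, −14815, 0, 50477668, 0]` (`−5·2963 = −14815`,
`4·2963·4259 = 50477668`). [cite: Zywina2025, Thm 1.2] -/
theorem zywinaCurveInt_659_12 : zywinaCurveInt 659 12 = ⟨0, -14815, 0, 50477668, 0⟩ := by
  ext <;> simp [zywinaCurveInt]

/-- `#Ẽ_{659,12}(𝔽₅) = 10` (the reduction is `y² = x³ + 3x` over `𝔽₅`), kernel-decided. [folklore] -/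
theorem card_five_659_12 :
    Nat.card (((⟨0, -14815, 0, 50477668, 0⟩ : WeierstrassCurve ℤ).map (Int.castRingHom (ZMod 5))).toAffine.Point)
      = 10 := by
  rw [PointCountNat.natCard_point_map_eq (hℓ := ⟨by norm_num⟩) (by norm_num) 0 (-14815) 0 50477668 0
    (by decide +kernel)]
  decide +kernel

variable [(zywinaCurve 659 12).IsGloballyMinimal]

/-- **The tree's integral model of `E_{659,12}` is `[0, −14815, 0, 50477668, 0]`.** [cite: Zywina2025, Lemma 3.4] -/
theorem intModel_659_12 : integralModelInt (zywinaCurve 659 12) = ⟨0, -14815, 0, 50477668, 0⟩ := by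
  rw [← zywinaCurveInt_659_12]
  have h := integralModelInt_zywinaCurve zywinaAdmissible_659_12
  convert h

/-! ## `q = 5` is good ordinary for `E_{659,12}` -/

/-- **`a₅(E_{659,12}) = −4`.** [folklore] -/
theorem frobeniusTrace_five_659_12 :
    haveI : Fact (Nat.Prime 5) := ⟨by norm_num⟩
    (zywinaCurve 659 12).frobeniusTrace 5 = -4 := by
  haveI : Fact (Nat.Prime 5) := ⟨by norm_num⟩
  rw [IntModel.frobeniusTrace_eq intModel_659_12 card_five_659_12]
  norm_num

/-- **`5` is a prime of good ordinary reduction of `E_{659,12}`**: `5 ∤ Δ_min(E_{659,12}) = Δ([0, −14815, 0, 50477668, 0])`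
and `5 ∤ a₅ = −4`. UNCONDITIONAL. [cite: SilvermanAEC2009, VII.5 Prop. 5.1 (a)] -/
theorem goodOrdinary_five_659_12 :
    haveI : Fact (Nat.Prime 5) := ⟨by norm_num⟩
    (zywinaCurve 659 12).HasGoodReductionAtPrime 5 ∧ ¬ ((5 : ℕ) : ℤ) ∣ (zywinaCurve 659 12).frobeniusTrace 5 := by
  haveI : Fact (Nat.Prime 5) := ⟨by norm_num⟩
  refine ⟨hasGoodReductionAtPrime_of_not_dvd _ 5 ?_, ?_⟩
  · rw [IntModel.minimalDiscriminantInt_eq intModel_659_12]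
    decide +kernel
  · rw [frobeniusTrace_five_659_12]
    decide

/-- `5` is good ordinary for `E_{659,12}` in the `IsOrdinaryAt` packaging of the `p`-adic `L`-function files.
[cite: SilvermanAEC2009, VII.5 Prop. 5.1 (a)] -/
theorem isOrdinaryAt_five_659_12 :
    haveI : Fact (Nat.Prime 5) := ⟨by norm_num⟩
    IsOrdinaryAt (zywinaCurve 659 12) 5 :=
  goodOrdinary_five_659_12

/-! ## The cell `(E_{659,12}, p₀ = 2, q = 5)` -/

variable [(zywinaCurve 659 12).IsElliptic]

omit [(zywinaCurve 659 12).IsGloballyMinimal] in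
/-- The door column of the cell (tree theorems): `rank E_{659,12}(ℚ) = 2`, `t_2(E_{659,12}) = 0`,
`corank_{ℤ₅} Sel_{5^∞}(E_{659,12}/ℚ) = 2 + t_5(E_{659,12})`. UNCONDITIONAL. [cite: Zywina2025, Thm 1.2]
[cite: GreenbergLNM1716, §1 (pp. 54–57)] -/
theorem doorColumn_659_12 :
    haveI : Fact (Nat.Prime 5) := ⟨by norm_num⟩
    (zywinaCurve 659 12).mordellWeilRank = 2 ∧ (zywinaCurve 659 12).shaCorank 2 = 0 ∧
      (zywinaCurve 659 12).selmerCorank 5 = 2 + (zywinaCurve 659 12).shaCorank 5 := by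
  haveI : Fact (Nat.Prime 5) := ⟨by norm_num⟩
  refine ⟨mordellWeilRank_zywinaCurve zywinaAdmissible_659_12, shaCorank_two_zywinaCurve zywinaAdmissible_659_12, ?_⟩
  rw [(zywinaCurve 659 12).selmerCorank_eq_mordellWeilRank_add_holds 5, mordellWeilRank_zywinaCurve zywinaAdmissible_659_12]

/-- **THE CELL.** Granting Kato's Thm. 18.4 at `5` for `E_{659,12}` (named fact
`kato_selmerCorank_le_order_padicLFunction`, `f` the newform of `E_{659,12}`) and the numerical certificate
`[T²] L_5(E_{659,12}, T) ≠ 0`: `Ш(E_{659,12}/ℚ)[5^∞]` is finite, `corank_{ℤ₅} Sel_{5^∞} = 2`, `t_5 = 0`,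
`ord_{T=0} L_5 = 2` — T's instance `(E_{659,12}, 2, 5)` with hypothesis AND conclusion certified (modulo print +
certificate). CONDITIONAL on `hK`, `hf`, `hcoeff`. [cite: Kato2004Asterisque, Thm. 18.4 (p. 281)]
[cite: SteinWuthrich2013, Algorithm 11.1 (3) (p. 27)] -/
theorem crossPrimeRow_659_12_five [Fact (Nat.Prime 5)] {N : ℕ} [NeZero N] {f : CuspForm (Gamma0 N) 2}
    (hK : kato_selmerCorank_le_order_padicLFunction (zywinaCurve 659 12) 5 (f := f))
    (hf : IsNewformOf (zywinaCurve 659 12) f)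
    (hcoeff : PowerSeries.coeff 2 (padicLFunction f (unitRoot (zywinaCurve 659 12) 5 : ℚ_[5])) ≠ 0) :
    Finite ↥(AddCommGroup.primaryComponent (zywinaCurve 659 12).sha 5) ∧
      (zywinaCurve 659 12).selmerCorank 5 = 2 ∧ (zywinaCurve 659 12).shaCorank 5 = 0 ∧
      (padicLFunction f (unitRoot (zywinaCurve 659 12) 5 : ℚ_[5])).order = 2 := by
  have hord : IsOrdinaryAt (zywinaCurve 659 12) 5 := by convert isOrdinaryAt_five_659_12
  obtain ⟨hfin, -, hsel, hsha, hordr⟩ :=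
    finite_sha_primary_of_coeff_padicLFunction_ne_zero (zywinaCurve 659 12) 5 hK (by decide) hord hf hcoeff
      (by rw [mordellWeilRank_zywinaCurve zywinaAdmissible_659_12])
  exact ⟨hfin, hsel, hsha, by rw [hordr]; rfl⟩

/-- **X2 at the cell.** Granting KatoTransfer's X2 = `AnalyticRankLeSelmerCorank` (at the good ordinary prime `5` of
the global minimal model `E_{659,12}`): `ord_{s=1} L(E_{659,12}, s) ≤ 2 + t_5(E_{659,12})`. CONDITIONAL on `hX2`.
[cite: GreenbergLNM1716, §1 (pp. 54–57)] -/
theorem analyticRank_659_12_le_of_X2 [Fact (Nat.Prime 5)] (hX2 : AnalyticRankLeSelmerCorank) :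
    (zywinaCurve 659 12).analyticRank ≤ 2 + (zywinaCurve 659 12).shaCorank 5 := by
  have hgo : (zywinaCurve 659 12).HasGoodReductionAtPrime 5 ∧
      ¬ ((5 : ℕ) : ℤ) ∣ (zywinaCurve 659 12).frobeniusTrace 5 := by convert goodOrdinary_five_659_12
  have h := hX2 (zywinaCurve 659 12) 5 (by norm_num) hgo.1 hgo.2
  rw [(zywinaCurve 659 12).selmerCorank_eq_mordellWeilRank_add_holds 5,
    mordellWeilRank_zywinaCurve zywinaAdmissible_659_12] at h
  exact h

/-- **X2 ∧ T at the cell**: `ord_{s=1} L(E_{659,12}, s) ≤ 2`, the transfer carrying the proved `t_2 = 0` to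
`t_5 = 0`. CONDITIONAL on `hX2`, `hT`. [cite: GreenbergLNM1716, §1 (pp. 54–57)] -/
theorem analyticRank_659_12_le_two_of_X2_of_transfer [Fact (Nat.Prime 5)] (hX2 : AnalyticRankLeSelmerCorank)
    (hT : FiniteShaComponentTransfer) : (zywinaCurve 659 12).analyticRank ≤ 2 := by
  have h := analyticRank_659_12_le_of_X2 hX2
  rw [hT (zywinaCurve 659 12) 2 5 (shaCorank_two_zywinaCurve zywinaAdmissible_659_12), add_zero] at h
  exact h

end Summit.BirchSwinnertonDyer.BirchSwinnertonDyer.Theorems.ShaPrimaryTransferRowAtFive
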